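import Literature.NumberTheory.EllipticCurves.PAdicHeightsProofs

/-!
# Discharge of `WeierstrassCurve.TateParameterData.valuation_q_eq` (`ord_p q = ord_p Δ_min`)

Proof of the named fact `WeierstrassCurve.TateParameterData.valuation_q_eq` stated in
`Literature/NumberTheory/EllipticCurves/PAdicHeights.lean` (Mazur–Tate–Teitelbaum 1986, §II.1;
Silverman ATAEC Thm. V.3.1(b)): for a Tate parameter datum `D : TateParameterData W p` of `E/ℚ` at a
prime `p` of split multiplicative reduction, `ord_p D.q = ord_p Δ(E')`, where
`E' = (W.baseChange ℚ_[p]).minimal ℤ_[p]` is Mathlib's `ℤ_p`-minimal model of `E/ℚ_p`.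

The declarations are deliberate dot-notation extensions of Mathlib's `namespace WeierstrassCurve`,
as in the statement file; this sibling file keeps `PAdicHeights.lean` a definitions file and
`PAdicHeightsProofs.lean` unchanged.

## Proof architecture

Silverman (ATAEC V.4, display after Thm. V.4.2, p. 430 of the held text) records
"for a Tate curve, `v(q) = -v(j(E_q)) = v(Δ(q))`". We run exactly this chain through the
`j`-invariant, which is what the datum pins down (`D.tateJ_eq : j(q) = j(E)`):

* `ord_p j(E) = -ord_p q`: this is `TateParameterData.valuation_j_holds'`
  (`PAdicHeightsProofs.lean`, from `‖j(q)‖ = ‖q‖⁻¹`, ATAEC V.3.1(b)/Lemma V.5.1);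
* `ord_p j(E) = -ord_p Δ(E')` for the minimal model `E'` at a prime of multiplicative reduction
  (`WeierstrassCurve.valuation_j_eq_neg_valuation_Δ_of_hasMultiplicativeReductionAtPrime` below):
  Mathlib's *definition* `WeierstrassCurve.HasMultiplicativeReduction` is Silverman's criterion
  [AEC, Prop. VII.5.1(b)] `v(Δ(E')) > 0`, `v(c₄(E')) = 0` for the minimal equation, and
  `j(E) = j(E') = c₄(E')³ / Δ(E')` (invariance of `j` under base change and change of variables),
  so `ord_p j(E) = 3 · 0 - ord_p Δ(E')`.

Hence `ord_p q = ord_p Δ(E')`. (The equality with the *global* minimal discriminant,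
`valuation_q_eq_padicValInt`, additionally needs "a global minimal model is minimal at `p`" and is
not treated here.)

## References

* [MazurTateTeitelbaum1986Invent] B. Mazur, J. Tate, J. Teitelbaum, *On `p`-adic analogues of the
  conjectures of Birch and Swinnerton-Dyer*, Invent. Math. 84 (1986) 1–48, §II.1 (the Tate period
  `q_E` of a curve with split multiplicative reduction; the held scan carries no text layer, the
  statement is checked against Silverman below).
* [SilvermanATAEC1994] J. H. Silverman, *Advanced Topics in the Arithmetic of Elliptic Curves*,
  GTM 151, Springer 1994: Thm. V.3.1(b) (`Δ(E_q) = q ∏ (1 - qⁿ)²⁴`, `|Δ(q)| = |q|`,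
  `j(E_q) = 1/q + 744 + ⋯`), and V.4, p. 430: "`v(q) = -v(j(E_q)) = v(Δ(q))`".
* [SilvermanAEC2009] J. H. Silverman, *The Arithmetic of Elliptic Curves*, 2nd ed., GTM 106,
  Springer 2009, Prop. VII.5.1(b) (p. 174 of the held text): a minimal equation has multiplicative
  reduction iff `v(Δ) > 0` and `v(c₄) = 0`.
-/

noncomputable section

namespace WeierstrassCurve

open IsDedekindDomain Literature.NumberTheory.EllipticCurves

variable {W : WeierstrassCurve ℚ} {p : ℕ} [Fact p.Prime]

/-- At a prime `p` of multiplicative reduction, `ord_p j(E) = -ord_p Δ(E')` for the `ℤ_p`-minimal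
model `E' = (W.baseChange ℚ_[p]).minimal ℤ_[p]` of `E/ℚ_p`: by Mathlib's definition
`WeierstrassCurve.HasMultiplicativeReduction` (= [AEC, Prop. VII.5.1(b)]) the minimal equation has
`v(c₄(E')) = 0`, and `j(E) = j(E') = c₄(E')³ / Δ(E')`. Deliberate dot-notation extension of
Mathlib's `WeierstrassCurve` namespace. [cite: SilvermanAEC2009, Prop. VII.5.1(b)] -/
theorem valuation_j_eq_neg_valuation_Δ_of_hasMultiplicativeReductionAtPrime [W.IsElliptic]
    (h : W.HasMultiplicativeReductionAtPrime p) :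
    Padic.valuation (W.j : ℚ_[p]) = -Padic.valuation ((W.baseChange ℚ_[p]).minimal ℤ_[p]).Δ := by
  set W' : WeierstrassCurve ℚ_[p] := W.baseChange ℚ_[p] with hW'
  set Wm : WeierstrassCurve ℚ_[p] := W'.minimal ℤ_[p] with hWm
  have hmul : Wm.HasMultiplicativeReduction ℤ_[p] := h
  haveI : IsMinimal ℤ_[p] Wm := hmul.toIsMinimal
  -- `c₄` of the minimal model is a `p`-adic unit
  obtain ⟨rc, hrc⟩ : ∃ r : ℤ_[p], (r : ℚ_[p]) = Wm.c₄ := ⟨_, integralModel_c₄_eq ℤ_[p] Wm⟩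
  have hc₄ := hmul.multiplicativeReduction
  rw [← hrc, ← PadicInt.algebraMap_apply, HeightOneSpectrum.valuation_eq_one_iff_notMem] at hc₄
  change rc ∉ IsLocalRing.maximalIdeal ℤ_[p] at hc₄
  rw [IsLocalRing.mem_maximalIdeal, PadicInt.mem_nonunits] at hc₄
  have hc₄' : ‖(rc : ℚ_[p])‖ = 1 := by
    rw [← PadicInt.norm_def]
    exact le_antisymm (PadicInt.norm_le_one _) (not_lt.mp hc₄)
  have hrc0 : (rc : ℚ_[p]) ≠ 0 := norm_pos_iff.mp (by rw [hc₄']; exact one_pos)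
  have hp0 : (0 : ℝ) ≤ p := by positivity
  have hp1 : (p : ℝ) ≠ 1 := by exact_mod_cast (Fact.out : p.Prime).ne_one
  have hvc : Padic.valuation (rc : ℚ_[p]) = 0 := by
    have hn := Padic.norm_eq_zpow_neg_valuation hrc0
    rw [hc₄'] at hn
    have := (zpow_eq_one_iff_right₀ hp0 hp1).mp hn.symm
    omega
  -- `j(E)` in terms of the minimal model
  have hΔ0 : W.Δ ≠ 0 := W.isUnit_Δ.ne_zero
  have hj : (W.j : ℚ_[p]) = Wm.c₄ ^ 3 / Wm.Δ := by
    have h1 : W.j = W.c₄ ^ 3 / W.Δ := by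
      rw [j, ← coe_Δ', Units.val_inv_eq_inv_val]; ring
    rw [hWm, WeierstrassCurve.minimal, variableChange_c₄, variableChange_Δ, hW', h1]
    simp only [baseChange, map_c₄, map_Δ, eq_ratCast]
    set u : ℚ_[p]ˣ := ((W.baseChange ℚ_[p]).exists_isMinimal ℤ_[p]).choose.u⁻¹
    have hΔ0' : (algebraMap ℚ ℚ_[p]) W.Δ ≠ 0 := by simpa using hΔ0
    have hu : (u : ℚ_[p]) ≠ 0 := u.ne_zero
    push_cast
    field_simp
  have hΔne : Wm.Δ ≠ 0 := by
    intro hz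
    apply hΔ0
    rw [hWm, WeierstrassCurve.minimal, variableChange_Δ, hW'] at hz
    simpa [baseChange, map_Δ] using hz
  rw [hj, div_eq_mul_inv, Padic.valuation_mul (pow_ne_zero _ (hrc ▸ hrc0)) (inv_ne_zero hΔne),
    Padic.valuation_pow, Padic.valuation_inv, ← hrc, hvc]
  ring

namespace TateParameterData

/-- **Discharge of `TateParameterData.valuation_q_eq`** (`ord_p q = ord_p Δ_min`, Mazur–Tate–
Teitelbaum 1986, §II.1; Silverman ATAEC Thm. V.3.1(b) and V.4, p. 430:
"`v(q) = -v(j(E_q)) = v(Δ(q))`"): for every Tate parameter datum `D` of `E/ℚ` at `p`,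
`ord_p D.q = ord_p Δ(E')` with `E' = (W.baseChange ℚ_[p]).minimal ℤ_[p]`. Proof:
`ord_p j(E) = -ord_p q` (`valuation_j_holds'`) and `ord_p j(E) = -ord_p Δ(E')`
(`valuation_j_eq_neg_valuation_Δ_of_hasMultiplicativeReductionAtPrime`, using `D.split`).
[cite: MazurTateTeitelbaum1986Invent, §II.1] -/
theorem valuation_q_eq_holds [W.IsElliptic] : valuation_q_eq (W := W) (p := p) := by
  intro D
  have h₁ := valuation_j_holds' (W := W) (p := p) D
  have h₂ := valuation_j_eq_neg_valuation_Δ_of_hasMultiplicativeReductionAtPrime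
    D.split.hasMultiplicativeReductionAtPrime
  omega

end TateParameterData

end WeierstrassCurve

end
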